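import Literature.NumberTheory.EllipticCurves.PAdicLFunctionMultiplicativeFunctionalEquationProofs
import HarnessLib

/-!
# Riemann-sum certificates for the transform of a bounded distribution, and for THE `p`-adic
# `L`-function at a NON-SPLIT multiplicative prime (theorems only; no definition, no named fact)

Topic `Literature/NumberTheory/EllipticCurves`; sequel of `PAdicMeasureTransform.lean` (abstract
Mellin transform of a bounded distribution `μ` on `ℤ_p^×`: `norm_riemannSum_succ_sub_le_of_distribution`,
`tendsto_riemannSum_of_distribution`, `exists_powerSeries_of_bounded_distribution`), of
`PAdicLFunctionNonsplitMultiplicativeExistenceProofs.lean` (`exists_isMultPAdicLFunctionOf_neg_one_of_nonsplit`: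
at a non-split multiplicative prime the transform of the signed measure `μₙ(a) = (−1)ⁿ[a/pⁿ]⁺_f`
satisfies `IsMultPAdicLFunctionOf f p (-1)`) and of
`PAdicLFunctionMultiplicativeFunctionalEquationProofs.lean` (`IsMultPAdicLFunctionOf.unique`). It is
the non-split multiplicative twin of `PAdicLFunctionRiemannSumCertificateProofs.lean` (crux
stmt-0490, good ordinary `p`).

## What is proved

ABSTRACT (any `μ : (n : ℕ) → ℤ/pⁿ → ℚ_p` with the distribution relation and `‖μ‖ ≤ C`; Riemann sums
`RS k n = ∑_η ∑_{s mod pⁿ} μ(η γˢ + p^{n+e₀}ℤ_p)·(s choose k)` entered through the hypothesis `hRS`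
exactly as in `PAdicMeasureTransform`):
* `norm_riemannSum_sub_le_of_distribution` — `‖RS k m − RS k n‖ ≤ (C/‖k!‖_p)·p⁻ⁿ` for `n ≤ m`;
* `norm_limUnder_riemannSum_sub_le_of_distribution` — the TRUNCATION BOUND
  `‖c_k − RS k n‖ ≤ (C/‖k!‖_p)·p⁻ⁿ` for the coefficient `c_k = lim_n RS k n` of the transform;
* `norm_limUnder_riemannSum_eq_of_lt` — the CERTIFICATE: `(C/‖k!‖_p)·p⁻ⁿ < ‖RS k n‖ ⟹
  ‖c_k‖ = ‖RS k n‖ ∧ c_k ≠ 0`;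
* `exists_powerSeries_of_bounded_distribution_riemannSum` — the tree's existence theorem with the
  truncation bound as a fourth clause.

NON-SPLIT MULTIPLICATIVE `p` (`E = W/ℚ`, `f` its newform, `a_p = −1`; THE function `L` of the
package `IsMultPAdicLFunctionOf f p (-1) L` — unique, `IsMultPAdicLFunctionOf.unique`):
* `exists_isMultPAdicLFunctionOf_neg_one_riemannSum` — existence with the truncation bound against
  the Riemann sums of the signed measure, for ANY bound `C` of the plus symbols `‖[a/pⁿ]⁺_f‖_p ≤ C`;
* `IsMultPAdicLFunctionOf.norm_coeff_sub_riemannSum_le_of_nonsplit` — for EVERY `L` of the package,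
  `‖[T^k]L − RS k n‖ ≤ (C/‖k!‖_p)·p⁻ⁿ`;
* `IsMultPAdicLFunctionOf.norm_coeff_eq_of_nonsplit_of_lt` / `….coeff_ne_zero_of_nonsplit_of_lt` —
  `(C/‖k!‖_p)·p⁻ⁿ < ‖RS k n‖ ⟹ ‖[T^k]L‖ = ‖RS k n‖`, `[T^k]L ≠ 0`; for `k = 1` this is the
  per-pair certificate bit `hc1` of the O9 (X2 ∧ r = 1 ∧ non-split) Schneider node
  `Summits/…/X2/ClassClosureO9Certificate.schneider_of_coeff_one_ne_zero_of_thm1` in KERNEL form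
  (cell `b2b-bsdres`, lane CLASS-CLOSURE, seat cc-typer-6 GEN 7, O9 typer of record).

HONEST FRAMING: nothing about any particular curve is asserted; the bound `C` and the inequality are
hypotheses (an instrument's exact symbol table is EVIDENCE for them); nothing is booked.

References: [MazurTateTeitelbaum1986Invent] §I.10 Prop. (ε(p) = 0, α = a_p = −1), §I.11–I.14;
[SteinWuthrich2013] §3 (Riemann sums / precision), §4.2; [GreenbergLNM1716] §4 (the factor 2).
-/

noncomputable section

open Filter Topology
open scoped MatrixGroups ModularForm
open CongruenceSubgroup Literature.NumberTheory.EllipticCurves.ModularForms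

namespace Literature.NumberTheory.EllipticCurves

variable {p : ℕ} [Fact p.Prime]

/-! ### Abstract: truncation bound and certificate for the transform of a bounded distribution -/

section Abstract

variable {μ : (n : ℕ) → ZMod (p ^ n) → ℚ_[p]} {RS : ℕ → ℕ → ℚ_[p]}
  (hRS : ∀ k n : ℕ, RS k n =
      ∑ᶠ ξ : rootsOfUnity (torsionOrder p) ℤ_[p], ∑ s : ZMod (p ^ n),
        μ (n + cyclotomicExponent p)
            (PadicInt.toZModPow (n + cyclotomicExponent p) ((ξ : ℤ_[p]ˣ) : ℤ_[p]) *
              (cyclotomicGenerator p : ZMod (p ^ (n + cyclotomicExponent p))) ^ s.val) *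
          ((s.val.choose k : ℕ) : ℚ_[p]))

include hRS

/-- **Telescoped Cauchy estimate** for the Riemann sums of a bounded distribution: for `n ≤ m`,
`‖RS k m − RS k n‖ ≤ (C/‖k!‖_p)·p⁻ⁿ` (`norm_riemannSum_succ_sub_le_of_distribution` and the
ultrametric inequality). [cite: MazurTateTeitelbaum1986Invent, §I.11–I.13] -/
theorem norm_riemannSum_sub_le_of_distribution
    (hdist : ∀ (n : ℕ) (a : ZMod (p ^ n)),
      ∑ b ∈ Finset.univ.filter (fun b : ZMod (p ^ (n + 1)) ↦
        ZMod.castHom (pow_dvd_pow p n.le_succ) (ZMod (p ^ n)) b = a), μ (n + 1) b = μ n a)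
    {C : ℝ} (hC0 : 0 ≤ C) (hC : ∀ (n : ℕ) (a : ZMod (p ^ n)), ‖μ n a‖ ≤ C) (k : ℕ) {n m : ℕ}
    (hnm : n ≤ m) :
    ‖RS k m - RS k n‖ ≤ C / ‖((k.factorial : ℕ) : ℚ_[p])‖ * (p : ℝ) ^ (-n : ℤ) := by
  have hp1 : (1 : ℝ) ≤ p := by exact_mod_cast (Fact.out : p.Prime).one_lt.le
  have hK0 : 0 ≤ C / ‖((k.factorial : ℕ) : ℚ_[p])‖ := div_nonneg hC0 (norm_nonneg _)
  induction m, hnm using Nat.le_induction with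
  | base =>
    rw [sub_self, norm_zero]
    positivity
  | succ m hnm ih =>
    have hstep := norm_riemannSum_succ_sub_le_of_distribution hRS hdist hC0 hC k m
    have hmono : (p : ℝ) ^ (-m : ℤ) ≤ (p : ℝ) ^ (-n : ℤ) := zpow_le_zpow_right₀ hp1 (by omega)
    calc ‖RS k (m + 1) - RS k n‖ = ‖(RS k (m + 1) - RS k m) + (RS k m - RS k n)‖ := by
          rw [sub_add_sub_cancel]
      _ ≤ max ‖RS k (m + 1) - RS k m‖ ‖RS k m - RS k n‖ := IsUltrametricDist.norm_add_le_max _ _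
      _ ≤ C / ‖((k.factorial : ℕ) : ℚ_[p])‖ * (p : ℝ) ^ (-n : ℤ) :=
          max_le (hstep.trans (mul_le_mul_of_nonneg_left hmono hK0)) ih

/-- **Truncation bound** for the transform of a bounded distribution: the `k`-th coefficient
`c_k = lim_n RS k n` satisfies `‖c_k − RS k n‖ ≤ (C/‖k!‖_p)·p⁻ⁿ` (`c_k` is the limit,
`tendsto_riemannSum_of_distribution`; all later Riemann sums lie in that closed ball).
[cite: MazurTateTeitelbaum1986Invent, §I.11–I.13] [cite: SteinWuthrich2013, §3] -/
theorem norm_limUnder_riemannSum_sub_le_of_distribution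
    (hdist : ∀ (n : ℕ) (a : ZMod (p ^ n)),
      ∑ b ∈ Finset.univ.filter (fun b : ZMod (p ^ (n + 1)) ↦
        ZMod.castHom (pow_dvd_pow p n.le_succ) (ZMod (p ^ n)) b = a), μ (n + 1) b = μ n a)
    {C : ℝ} (hC : ∀ (n : ℕ) (a : ZMod (p ^ n)), ‖μ n a‖ ≤ C) (k n : ℕ) :
    ‖(limUnder atTop fun m ↦ RS k m) - RS k n‖ ≤
      C / ‖((k.factorial : ℕ) : ℚ_[p])‖ * (p : ℝ) ^ (-n : ℤ) := by
  have hC0 : 0 ≤ C := (norm_nonneg _).trans (hC 0 0)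
  have hlim : Tendsto (fun m ↦ RS k m - RS k n) atTop
      (𝓝 ((limUnder atTop fun m ↦ RS k m) - RS k n)) :=
    (tendsto_riemannSum_of_distribution hRS hdist hC k).sub tendsto_const_nhds
  refine le_of_tendsto hlim.norm ?_
  filter_upwards [eventually_ge_atTop n] with m hm
  exact norm_riemannSum_sub_le_of_distribution hRS hdist hC0 hC k hm

/-- **Certificate (isosceles)**: if one Riemann sum beats the truncation bound,
`(C/‖k!‖_p)·p⁻ⁿ < ‖RS k n‖`, then `‖c_k‖ = ‖RS k n‖` and `c_k ≠ 0`.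
[cite: MazurTateTeitelbaum1986Invent, §I.11–I.13] [cite: SteinWuthrich2013, §3] -/
theorem norm_limUnder_riemannSum_eq_of_lt
    (hdist : ∀ (n : ℕ) (a : ZMod (p ^ n)),
      ∑ b ∈ Finset.univ.filter (fun b : ZMod (p ^ (n + 1)) ↦
        ZMod.castHom (pow_dvd_pow p n.le_succ) (ZMod (p ^ n)) b = a), μ (n + 1) b = μ n a)
    {C : ℝ} (hC : ∀ (n : ℕ) (a : ZMod (p ^ n)), ‖μ n a‖ ≤ C) {k n : ℕ}
    (hlt : C / ‖((k.factorial : ℕ) : ℚ_[p])‖ * (p : ℝ) ^ (-n : ℤ) < ‖RS k n‖) :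
    ‖limUnder atTop fun m ↦ RS k m‖ = ‖RS k n‖ ∧ (limUnder atTop fun m ↦ RS k m) ≠ 0 := by
  have herr : ‖(limUnder atTop fun m ↦ RS k m) - RS k n‖ < ‖RS k n‖ :=
    (norm_limUnder_riemannSum_sub_le_of_distribution hRS hdist hC k n).trans_lt hlt
  have heq : ‖limUnder atTop fun m ↦ RS k m‖ = ‖RS k n‖ := by
    have h := IsUltrametricDist.norm_add_eq_max_of_norm_ne_norm herr.ne
    rw [sub_add_cancel, max_eq_right herr.le] at h
    exact h
  refine ⟨heq, fun h0 ↦ ?_⟩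
  have hC0 : 0 ≤ C := (norm_nonneg _).trans (hC 0 0)
  have hpos : 0 < ‖RS k n‖ :=
    lt_of_le_of_lt (mul_nonneg (div_nonneg hC0 (norm_nonneg _)) (zpow_nonneg (by positivity) _))
      hlt
  rw [h0, norm_zero] at heq
  exact hpos.ne heq

/-- **The transform of a bounded distribution, WITH the truncation bound** — the tree's
`exists_powerSeries_of_bounded_distribution` (bounded coefficients, constant term `μ(ℤ_p^×)`,
interpolation at the characters of `Γ`) and, as a fourth clause, `‖[T^k]L − RS k n‖ ≤
(C/‖k!‖_p)·p⁻ⁿ` for all `k`, `n` (same `L = ∑_k (lim_n RS k n) T^k`).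
[cite: MazurTateTeitelbaum1986Invent, §I.13–I.14 (14.3)] [cite: SteinWuthrich2013, §3] -/
theorem exists_powerSeries_of_bounded_distribution_riemannSum
    (hdist : ∀ (n : ℕ) (a : ZMod (p ^ n)),
      ∑ b ∈ Finset.univ.filter (fun b : ZMod (p ^ (n + 1)) ↦
        ZMod.castHom (pow_dvd_pow p n.le_succ) (ZMod (p ^ n)) b = a), μ (n + 1) b = μ n a)
    {C : ℝ} (hC : ∀ (n : ℕ) (a : ZMod (p ^ n)), ‖μ n a‖ ≤ C) :
    ∃ L : PowerSeries ℚ_[p],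
      (∀ k : ℕ, ‖PowerSeries.coeff k L‖ ≤ C) ∧
      PowerSeries.constantCoeff L =
        ∑ u : (ZMod (p ^ cyclotomicExponent p))ˣ, μ (cyclotomicExponent p) u ∧
      (∀ (m : ℕ) (χ : DirichletCharacter ℂ_[p] (p ^ (m + 1))), χ.Even →
        (∃ j : ℕ, orderOf χ = p ^ j) →
          HasSum (fun k : ℕ ↦ algebraMap ℚ_[p] ℂ_[p] (PowerSeries.coeff k L) *
              (χ (cyclotomicGenerator p : ZMod (p ^ (m + 1))) - 1) ^ k)
            (∑ a : ZMod (p ^ (m + 1)), χ a * algebraMap ℚ_[p] ℂ_[p] (μ (m + 1) a))) ∧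
      ∀ k n : ℕ, ‖PowerSeries.coeff k L - RS k n‖ ≤
        C / ‖((k.factorial : ℕ) : ℚ_[p])‖ * (p : ℝ) ^ (-n : ℤ) := by
  refine ⟨PowerSeries.mk fun k ↦ limUnder atTop fun n ↦ RS k n, fun k ↦ ?_, ?_,
    fun m χ heven hord ↦ ?_, fun k n ↦ ?_⟩
  · rw [PowerSeries.coeff_mk]
    exact norm_limUnder_riemannSum_le_of_distribution hRS hdist hC k
  · rw [← PowerSeries.coeff_zero_eq_constantCoeff_apply, PowerSeries.coeff_mk]
    exact (tendsto_const_nhds.congr fun n ↦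
      (riemannSum_zero_of_distribution hRS hdist n).symm).limUnder_eq
  · simp only [PowerSeries.coeff_mk]
    exact hasSum_limUnder_riemannSum_mul_pow_of_distribution hRS hdist hC χ heven hord
  · rw [PowerSeries.coeff_mk]
    exact norm_limUnder_riemannSum_sub_le_of_distribution hRS hdist hC k n

end Abstract

/-! ### THE `p`-adic `L`-function at a non-split multiplicative prime: Riemann-sum certificate -/

section Nonsplit

variable {W : WeierstrassCurve ℚ} {N : ℕ} [NeZero N] {f : CuspForm (Gamma0 N) 2}
  {RS : ℕ → ℕ → ℚ_[p]}
  (hRS : ∀ k n : ℕ, RS k n =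
      ∑ᶠ ξ : rootsOfUnity (torsionOrder p) ℤ_[p], ∑ s : ZMod (p ^ n),
        (fun (n : ℕ) (a : ZMod (p ^ n)) ↦
            (-1 : ℚ_[p]) ^ n * (ratPlusSymbol f ((a.val : ℚ) / (p : ℚ) ^ n) : ℚ_[p]))
          (n + cyclotomicExponent p)
            (PadicInt.toZModPow (n + cyclotomicExponent p) ((ξ : ℤ_[p]ˣ) : ℤ_[p]) *
              (cyclotomicGenerator p : ZMod (p ^ (n + cyclotomicExponent p))) ^ s.val) *
          ((s.val.choose k : ℕ) : ℚ_[p]))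

include hRS

/-- **Existence of `L_p(E, T)` at a NON-split multiplicative prime, WITH the truncation bound**:
for `f` the newform of `E = W/ℚ`, `p` non-split multiplicative, and ANY bound `C` of the plus
symbols at `p`-power denominators (`‖[a/pⁿ]⁺_f‖_p ≤ C`; such `C` exists,
`exists_norm_ratPlusSymbol_le`), the Mellin transform `L` of the signed measure
`μₙ(a) = (−1)ⁿ[a/pⁿ]⁺_f` satisfies `IsMultPAdicLFunctionOf f p (-1) L` (the tree's
`exists_isMultPAdicLFunctionOf_neg_one_of_nonsplit`, same proof) AND
`‖[T^k]L − RS k n‖ ≤ (C/‖k!‖_p)·p⁻ⁿ`, where `RS k n = ∑_η ∑_{s mod pⁿ}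
(−1)^{n+e₀}[η γˢ/p^{n+e₀}]⁺_f·(s choose k)` are its Riemann sums (`hRS`).
[cite: MazurTateTeitelbaum1986Invent, §I.10 Prop. and §I.14 (14.3)] [cite: SteinWuthrich2013, §3] -/
theorem exists_isMultPAdicLFunctionOf_neg_one_riemannSum (hf : IsNewformOf W f)
    (hmult : W.HasMultiplicativeReductionAtPrime p)
    (hns : ¬ W.HasSplitMultiplicativeReductionAtPrime p) {C : ℝ}
    (hC : ∀ (n : ℕ) (a : ZMod (p ^ n)), ‖(ratPlusSymbol f ((a.val : ℚ) / (p : ℚ) ^ n) : ℚ_[p])‖ ≤ C) :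
    ∃ L : PowerSeries ℚ_[p], IsMultPAdicLFunctionOf f p (-1) L ∧
      ∀ k n : ℕ, ‖PowerSeries.coeff k L - RS k n‖ ≤
        C / ‖((k.factorial : ℕ) : ℚ_[p])‖ * (p : ℝ) ^ (-n : ℤ) := by
  have hQ : coeffField f = ⊥ := hf.coeffField_eq_bot
  have hrat : ∀ r : ℚ, (ratPlusSymbol f r : ℝ) = normalizedPlusSymbol f r :=
    ratCast_ratPlusSymbol_holds hf.1 hQ
  obtain ⟨hap, hpN⟩ := hf.cuspCoeff_eq_neg_one_and_dvd_of_nonsplit hmult hns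
  have hfib := sum_fiber_ratPlusSymbol_eq_neg hrat hf.1 hpN hap
  have hdist : ∀ (n : ℕ) (a : ZMod (p ^ n)),
      ∑ b ∈ Finset.univ.filter (fun b : ZMod (p ^ (n + 1)) ↦
        ZMod.castHom (pow_dvd_pow p n.le_succ) (ZMod (p ^ n)) b = a),
        (-1 : ℚ_[p]) ^ (n + 1) * (ratPlusSymbol f ((b.val : ℚ) / (p : ℚ) ^ (n + 1)) : ℚ_[p]) =
        (-1 : ℚ_[p]) ^ n * (ratPlusSymbol f ((a.val : ℚ) / (p : ℚ) ^ n) : ℚ_[p]) := by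
    intro n a
    rw [← Finset.mul_sum, hfib n a]
    ring
  have hC' : ∀ (n : ℕ) (a : ZMod (p ^ n)),
      ‖(-1 : ℚ_[p]) ^ n * (ratPlusSymbol f ((a.val : ℚ) / (p : ℚ) ^ n) : ℚ_[p])‖ ≤ C := by
    intro n a
    rw [norm_mul, norm_pow, norm_neg, norm_one, one_pow, one_mul]
    exact hC n a
  obtain ⟨L, hbd, h0, hχ, hRSle⟩ := exists_powerSeries_of_bounded_distribution_riemannSum
    (μ := fun n a ↦ (-1 : ℚ_[p]) ^ n * (ratPlusSymbol f ((a.val : ℚ) / (p : ℚ) ^ n) : ℚ_[p]))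
    hRS hdist hC'
  refine ⟨L, ⟨memIwasawaRat_of_forall_norm_coeff_le hbd, ?_, fun m hm χ _ heven hord ↦ ?_⟩, hRSle⟩
  · rw [h0, sum_units_signed_ratPlusSymbol_eq hrat hf.1 hpN hap]
    norm_num
  · obtain ⟨m, rfl⟩ := Nat.exists_eq_succ_of_ne_zero hm.ne'
    have h := hχ m χ heven hord
    have hrhs : (∑ a : ZMod (p ^ (m + 1)), χ a * algebraMap ℚ_[p] ℂ_[p]
        ((-1 : ℚ_[p]) ^ (m + 1) * (ratPlusSymbol f ((a.val : ℚ) / (p : ℚ) ^ (m + 1)) : ℚ_[p]))) =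
        algebraMap ℚ_[p] ℂ_[p] ((-1 : ℚ_[p])⁻¹ ^ (m + 1)) * ratTwistedSymbolSum f χ := by
      rw [← sum_mul_algebraMap_ratPlusSymbol_eq, Finset.mul_sum, inv_neg, inv_one]
      refine Finset.sum_congr rfl fun a _ ↦ ?_
      rw [map_mul]
      ring
    rw [hrhs] at h
    exact h

/-- **Truncation bound for THE non-split function**: every `L` with `IsMultPAdicLFunctionOf f p (-1) L`
IS the transform of the signed measure (`IsMultPAdicLFunctionOf.unique`), hence
`‖[T^k]L − RS k n‖ ≤ (C/‖k!‖_p)·p⁻ⁿ` for any plus-symbol bound `C`.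
[cite: MazurTateTeitelbaum1986Invent, §I.14 (14.3)] [cite: SteinWuthrich2013, §3] -/
theorem IsMultPAdicLFunctionOf.norm_coeff_sub_riemannSum_le_of_nonsplit (hf : IsNewformOf W f)
    (hmult : W.HasMultiplicativeReductionAtPrime p)
    (hns : ¬ W.HasSplitMultiplicativeReductionAtPrime p) {C : ℝ}
    (hC : ∀ (n : ℕ) (a : ZMod (p ^ n)), ‖(ratPlusSymbol f ((a.val : ℚ) / (p : ℚ) ^ n) : ℚ_[p])‖ ≤ C)
    {L : PowerSeries ℚ_[p]} (hL : IsMultPAdicLFunctionOf f p (-1) L) (k n : ℕ) :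
    ‖PowerSeries.coeff k L - RS k n‖ ≤ C / ‖((k.factorial : ℕ) : ℚ_[p])‖ * (p : ℝ) ^ (-n : ℤ) := by
  obtain ⟨L₀, hL₀, hRSle⟩ := exists_isMultPAdicLFunctionOf_neg_one_riemannSum hRS hf hmult hns hC
  rw [hL.unique hL₀]
  exact hRSle k n

/-- **Certificate for THE non-split function**: if ONE Riemann sum of the signed measure beats the
truncation bound, `(C/‖k!‖_p)·p⁻ⁿ < ‖RS k n‖`, then `‖[T^k]L‖ = ‖RS k n‖` and `[T^k]L ≠ 0` for
every `L` of the package. [cite: SteinWuthrich2013, §3 and §4.2] [cite: MazurTateTeitelbaum1986Invent, §I.11–I.14] -/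
theorem IsMultPAdicLFunctionOf.norm_coeff_eq_of_nonsplit_of_lt (hf : IsNewformOf W f)
    (hmult : W.HasMultiplicativeReductionAtPrime p)
    (hns : ¬ W.HasSplitMultiplicativeReductionAtPrime p) {C : ℝ}
    (hC : ∀ (n : ℕ) (a : ZMod (p ^ n)), ‖(ratPlusSymbol f ((a.val : ℚ) / (p : ℚ) ^ n) : ℚ_[p])‖ ≤ C)
    {L : PowerSeries ℚ_[p]} (hL : IsMultPAdicLFunctionOf f p (-1) L) {k n : ℕ}
    (hlt : C / ‖((k.factorial : ℕ) : ℚ_[p])‖ * (p : ℝ) ^ (-n : ℤ) < ‖RS k n‖) :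
    ‖PowerSeries.coeff k L‖ = ‖RS k n‖ ∧ PowerSeries.coeff k L ≠ 0 := by
  have herr : ‖PowerSeries.coeff k L - RS k n‖ < ‖RS k n‖ :=
    (hL.norm_coeff_sub_riemannSum_le_of_nonsplit hRS hf hmult hns hC k n).trans_lt hlt
  have heq : ‖PowerSeries.coeff k L‖ = ‖RS k n‖ := by
    have h := IsUltrametricDist.norm_add_eq_max_of_norm_ne_norm herr.ne
    rw [sub_add_cancel, max_eq_right herr.le] at h
    exact h
  refine ⟨heq, fun h0 ↦ ?_⟩
  have hC0 : 0 ≤ C := (norm_nonneg _).trans (hC 0 0)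
  have hpos : 0 < ‖RS k n‖ :=
    lt_of_le_of_lt (mul_nonneg (div_nonneg hC0 (norm_nonneg _)) (zpow_nonneg (by positivity) _))
      hlt
  rw [h0, norm_zero] at heq
  exact hpos.ne heq

/-- **`[T^k]L ≠ 0` from one certified Riemann sum** (non-split multiplicative `p`; every `L` of the
package). For `k = 1` (`‖1!‖ = 1`): `C·p⁻ⁿ < ‖RS 1 n‖ ⟹ [T¹]L_p(E, T) ≠ 0` — the per-pair
certificate bit of the O9 non-split Schneider node in kernel form. [cite: SteinWuthrich2013, §3 and §4.2] -/
theorem IsMultPAdicLFunctionOf.coeff_ne_zero_of_nonsplit_of_lt (hf : IsNewformOf W f)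
    (hmult : W.HasMultiplicativeReductionAtPrime p)
    (hns : ¬ W.HasSplitMultiplicativeReductionAtPrime p) {C : ℝ}
    (hC : ∀ (n : ℕ) (a : ZMod (p ^ n)), ‖(ratPlusSymbol f ((a.val : ℚ) / (p : ℚ) ^ n) : ℚ_[p])‖ ≤ C)
    {L : PowerSeries ℚ_[p]} (hL : IsMultPAdicLFunctionOf f p (-1) L) {k n : ℕ}
    (hlt : C / ‖((k.factorial : ℕ) : ℚ_[p])‖ * (p : ℝ) ^ (-n : ℤ) < ‖RS k n‖) :
    PowerSeries.coeff k L ≠ 0 :=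
  (hL.norm_coeff_eq_of_nonsplit_of_lt hRS hf hmult hns hC hlt).2

end Nonsplit

end Literature.NumberTheory.EllipticCurves

end
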